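import Mathlib.Algebra.Order.BigOperators.Group.Finset
import Mathlib.Algebra.BigOperators.Field
import Mathlib.Data.Real.Basic
import Mathlib.Data.List.Basic
import Mathlib.Tactic.Positivity
import Mathlib.Tactic.Linarith
import Mathlib.Tactic.FieldSimp
import HarnessLib

/-!
# Borinsky's `2ⁿ`-table recursion `J_r` for the Hepp-sector normalisation and the sector-sampling probabilities of his Algorithm 4 (AIHPD 2023 = arXiv:2008.12310, §6.2: eq. (40), Definition 28, Proposition 29 and its proof, Algorithm 4, Proposition 31 — discrete part)

Source [Borinsky2020]: M. Borinsky, "Tropical Monte Carlo quadrature for Feynman integrals", Ann. Inst. Henri Poincaré D 10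
(2023) 635–685 = arXiv:2008.12310v2; e-print `tropical.tex` (deposited on the pub-qed HOME under `data/lit/sources/.cache/2008.12310/`;
theorem numbering = the e-print's flat counter, verified against Borinsky–Munch–Tellander 2023's printed cross-references), VERBATIM
(tex l.1102–1144):
"First observe that the overall normalization factor needed to apply Algorithm 3 is given by I^tr = Σ_{σ∈S_n} I^tr_{C_σ} with
I^tr_{C_σ} = 1/Π_{k=1}^{n−1} r(A^σ_k), (40) where r(A) = z_𝒜(A) − z_ℬ(A) for all non-empty A ⊊ [n]." [with, from Theorem 27,
"A^σ_k = {σ(1), …, σ(k)} ⊂ [n] = {1,…,n}", "r(A) > 0 for all non-empty proper subsets A ⊊ [n]"] "For the following considerations it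
will be convenient to declare r(∅) = 1, which opens the way towards the following generalization that promotes I^tr to a boolean
function on 2^[n]: **Definition 28.** For a boolean function r : 2^[n] → ℝ with r(∅) = 1 and r(A) > 0 for all non-empty A ⊊ [n], we
define the boolean function J_r : 2^[n] → ℝ_{>0} recursively as J_r(A) = Σ_{e∈A} J_r(A∖e)/r(A∖e) for all non-empty A ⊂ [n] where
J_r(∅) = 1. **Proposition 29.** If r(A) = z_𝒜(A) − z_ℬ(A) for all non-empty A ⊊ [n] and r(∅) = 1, then I^tr = J_r([n]). *Proof.* We
will prove that J_r(A) = Σ_{σ : [m] → A} 1/Π_{k=1}^{m−1} r(A^σ_k), where the sum is over all bijections σ : [m] → A. Fixing such a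
bijection is equivalent to fixing a pair (e, µ) of an element e ∈ A and a bijection µ : [m−1] → A∖e. Decomposing the sum in this way
and using eq. (40) gives the statement." "If we prepare a table of the values J_r(A) and r(A) for all A ⊂ [n], we can run the
following algorithm: **Algorithm 4** [to generate a sample from µ^tr for generalized permutahedra]: Set A = [n] and κ = 1. while
A ≠ ∅: Pick a random e ∈ A with probability p_e = (1/J_r(A)) · J_r(A∖e)/r(A∖e). Remove e from A, i.e. set A ← A∖e. Set σ(|A|) = e.
Set x_e = κ. Pick a uniformly distributed random number ξ ∈ [0,1]. Set κ ← κ ξ^{1/r(A)}. … Note that the probability distribution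
p_e = (1/J_r(A)) J_r(A∖e)/r(A∖e) over the elements e ∈ A is properly normalized due to Definition 28." Proof of Proposition 31
(tex l.1152–1157): "… We identify A_k ∖ e_k = A_{k−1}. The terms J_r(A_k∖e_k) telescope, J_r(∅) = r(∅) = 1 and we get
E[f(x)] = (1/J_r(A_n)) Σ_{e_n∈A_n} … Σ_{e_1∈A_1} 1/(r(A_n)⋯r(A_1)) ∫ f … The sum can be written as a sum over all permutations in
σ ∈ S_n and A_k = A^σ_k." And (l.1159): "Compared to the naiver approach where a table of size n! is needed, only a table of size 2ⁿ
is required. … The table for J_r(A) can be calculated in O(n 2ⁿ) steps."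

TYPING (finite ground set = any type `ι` with decidable equality, `A : Finset ι`, `r : Finset ι → ℝ`): `sectorTable r A` = J_r(A)
(Definition 28, by recursion on `|A|`); an ORDERING of `A` is listed in Algorithm 4's REMOVAL order — the element removed first gets
the last label `σ(|A|)` — so the list `(σ(m), σ(m−1), …, σ(1))` has successive tails with element sets `A^σ_{m−1} ⊋ ⋯ ⊋ A^σ_1 ⊋ ∅`,
and `orderingWeight r l = Π_k 1/r(A^σ_k)` is the per-sector normalisation `I^tr_{C_σ}` of (40) (using the printed convention
`r(∅) = 1` for the innermost factor); `orderings A` = the finite set of such lists (`mem_orderings`: exactly the duplicate-free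
lists with element set `A`). PROVED: Definition 28's two clauses (`sectorTable_empty`, `sectorTable_eq`); the identity in the
proof of Proposition 29, `J_r(A) = Σ_{orderings} Π_k 1/r(A^σ_k)` (`sectorTable_eq_sum_orderingWeight`); `J_r > 0`
(`sectorTable_pos`); Algorithm 4's one-step normalisation `Σ_{e∈A} p_e = 1` (`sum_stepProb`); the telescoping of the proof of
Proposition 31: Algorithm 4 outputs the ordering `σ` with probability `I^tr_{C_σ}/J_r(A)` (`runProb_eq`) and these sum to `1`
(`sum_runProb`). NOT typed: the continuous part of Algorithm 4 / Proposition 31 (the `ξ^{1/r(A)}` coordinates realise the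
per-sector measure of Theorem 27) and Proposition 29's identification `r = z_𝒜 − z_ℬ` with generalized-permutahedron data
(Theorem 27 itself). (Filed by the pub-qed literature seat for the IR/SE lane's sector-decomposition row — human ruling (a),
`irse/lit/SECTOR-DECOMP-EXTRACT-lit.md` §3.5; VALUE-FREE. independent recomputation; certified where stated, statistical where
stated; no new-physics claim.)
-/

namespace Literature.MathematicalPhysics.QuantumFieldTheory.Borinsky2020

open Finset

variable {ι : Type*} [DecidableEq ι]

section Table

/-- Fuel form of Definition 28 (recursion on an explicit bound for `|A|`). [cite: Borinsky2020, §6.2 Definition 28] -/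
noncomputable def sectorTableAux (r : Finset ι → ℝ) : ℕ → Finset ι → ℝ
  | 0, _ => 1
  | n + 1, A => ∑ e ∈ A, sectorTableAux r n (A.erase e) / r (A.erase e)

/-- **Definition 28**: "J_r(A) = Σ_{e∈A} J_r(A∖e)/r(A∖e) for all non-empty A ⊂ [n] where J_r(∅) = 1" — the `2ⁿ`-table.
[cite: Borinsky2020, §6.2 Definition 28] -/
noncomputable def sectorTable (r : Finset ι → ℝ) (A : Finset ι) : ℝ := sectorTableAux r A.card A

/-- `J_r(∅) = 1`. [cite: Borinsky2020, §6.2 Definition 28] -/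
theorem sectorTable_empty (r : Finset ι → ℝ) : sectorTable r (∅ : Finset ι) = 1 := by
  simp [sectorTable, sectorTableAux]

/-- `J_r(A) = Σ_{e∈A} J_r(A∖e)/r(A∖e)` for non-empty `A`. [cite: Borinsky2020, §6.2 Definition 28] -/
theorem sectorTable_eq (r : Finset ι → ℝ) {A : Finset ι} (hA : A.Nonempty) :
    sectorTable r A = ∑ e ∈ A, sectorTable r (A.erase e) / r (A.erase e) := by
  unfold sectorTable
  obtain ⟨n, hn⟩ : ∃ n, A.card = n + 1 := Nat.exists_eq_add_one_of_ne_zero (card_ne_zero.mpr hA)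
  rw [hn, sectorTableAux]
  refine sum_congr rfl fun e he => ?_
  rw [card_erase_of_mem he, hn, Nat.add_sub_cancel]

/-- `J_r : 2^[n] → ℝ_{>0}`: `J_r(A) > 0` as soon as `r(B) > 0` for all proper subsets `B ⊊ A` (printed: "r(A) > 0 for all non-empty
A ⊊ [n]" and "r(∅) = 1"). [cite: Borinsky2020, §6.2 Definition 28] -/
theorem sectorTable_pos (r : Finset ι → ℝ) {A : Finset ι} (hr : ∀ B, B ⊂ A → 0 < r B) : 0 < sectorTable r A := by
  suffices h : ∀ (n : ℕ) (A : Finset ι), A.card = n → (∀ B, B ⊂ A → 0 < r B) → 0 < sectorTable r A from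
    h _ A rfl hr
  intro n
  induction n with
  | zero =>
    intro A h _
    rw [card_eq_zero.mp h, sectorTable_empty]
    exact one_pos
  | succ n ih =>
    intro A h hr
    have hA : A.Nonempty := card_pos.mp (by omega)
    rw [sectorTable_eq r hA]
    refine sum_pos (fun e he => ?_) hA
    have hsub : A.erase e ⊂ A := erase_ssubset he
    have hcard : (A.erase e).card = n := by rw [card_erase_of_mem he, h, Nat.add_sub_cancel]
    exact div_pos (ih _ hcard (fun B hB => hr B (hB.trans hsub))) (hr _ hsub)

/-- Algorithm 4's one-step law: "Pick a random e ∈ A with probability p_e = (1/J_r(A)) · J_r(A∖e)/r(A∖e)".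
[cite: Borinsky2020, §6.2 Algorithm 4] -/
noncomputable def stepProb (r : Finset ι → ℝ) (A : Finset ι) (e : ι) : ℝ :=
  sectorTable r (A.erase e) / r (A.erase e) / sectorTable r A

/-- "Note that the probability distribution p_e … over the elements e ∈ A is properly normalized due to Definition 28":
`Σ_{e∈A} p_e = 1` (for non-empty `A` with `J_r(A) ≠ 0`). [cite: Borinsky2020, §6.2 (sentence after Algorithm 4)] -/
theorem sum_stepProb (r : Finset ι → ℝ) {A : Finset ι} (hA : A.Nonempty) (hJ : sectorTable r A ≠ 0) :
    ∑ e ∈ A, stepProb r A e = 1 := by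
  simp only [stepProb]
  rw [← sum_div, ← sectorTable_eq r hA, div_self hJ]

end Table

section Orderings

/-- Fuel form of the set of orderings (removal sequences) of `A`. [cite: Borinsky2020, §6.2 proof of Proposition 29] -/
def orderingsAux : ℕ → Finset ι → Finset (List ι)
  | 0, _ => {[]}
  | n + 1, A => A.biUnion fun e => (orderingsAux n (A.erase e)).image (List.cons e)

/-- The orderings of `A` ("all bijections σ : [m] → A"), each listed in Algorithm 4's removal order `(σ(m), σ(m−1), …, σ(1))`
("Set σ(|A|) = e" for the element removed first). [cite: Borinsky2020, §6.2 proof of Proposition 29 and Algorithm 4] -/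
def orderings (A : Finset ι) : Finset (List ι) := orderingsAux A.card A

/-- The orderings of `A` are exactly the duplicate-free lists whose element set is `A`. [cite: Borinsky2020, §6.2 proof of
Proposition 29 ("the sum is over all bijections σ : [m] → A")] -/
theorem mem_orderings {A : Finset ι} {l : List ι} : l ∈ orderings A ↔ l.Nodup ∧ l.toFinset = A := by
  suffices h : ∀ (n : ℕ) (A : Finset ι) (l : List ι), A.card = n →
      (l ∈ orderingsAux n A ↔ l.Nodup ∧ l.toFinset = A) by
    unfold orderings; exact h _ A l rfl
  intro n
  induction n with
  | zero =>
    intro A l h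
    rw [card_eq_zero.mp h]
    simp only [orderingsAux, mem_singleton]
    constructor
    · rintro rfl; simp
    · rintro ⟨-, hl⟩; exact (List.toFinset_eq_empty_iff _).mp hl
  | succ n ih =>
    intro A l h
    simp only [orderingsAux, mem_biUnion, mem_image]
    constructor
    · rintro ⟨e, he, t, ht, rfl⟩
      have hcard : (A.erase e).card = n := by rw [card_erase_of_mem he, h, Nat.add_sub_cancel]
      obtain ⟨hnd, htA⟩ := (ih _ t hcard).mp ht
      have het : e ∉ t := fun hmem => by
        have : e ∈ t.toFinset := List.mem_toFinset.mpr hmem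
        rw [htA] at this; exact notMem_erase e A this
      exact ⟨List.nodup_cons.mpr ⟨het, hnd⟩, by rw [List.toFinset_cons, htA, insert_erase he]⟩
    · rintro ⟨hnd, hlA⟩
      cases l with
      | nil => exact absurd h (by rw [← hlA]; simp)
      | cons e t =>
        have he : e ∈ A := by rw [← hlA]; simp
        have het : e ∉ t := (List.nodup_cons.mp hnd).1
        have htA : t.toFinset = A.erase e := by
          rw [← hlA, List.toFinset_cons, erase_insert (fun hm => het (List.mem_toFinset.mp hm))]
        have hcard : (A.erase e).card = n := by rw [card_erase_of_mem he, h, Nat.add_sub_cancel]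
        exact ⟨e, he, t, (ih _ t hcard).mpr ⟨(List.nodup_cons.mp hnd).2, htA⟩, rfl⟩

/-- The per-sector normalisation `I^tr_{C_σ} = 1/Π_{k=1}^{m−1} r(A^σ_k)` of eq. (40), read off an ordering listed in removal order:
the tail after removing the first element has element set `A^σ_{m−1}`, and so on down to `A^σ_1` and `∅` (whose factor is
`1/r(∅) = 1` by the printed convention). [cite: Borinsky2020, §6.2 eq. (40) and Definition 28 ("declare r(∅) = 1")] -/
noncomputable def orderingWeight (r : Finset ι → ℝ) : List ι → ℝ
  | [] => 1
  | _ :: t => orderingWeight r t / r t.toFinset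

/-- `orderingWeight r [] = 1`. [cite: Borinsky2020, §6.2 eq. (40)] -/
@[simp] theorem orderingWeight_nil (r : Finset ι → ℝ) : orderingWeight r ([] : List ι) = 1 := rfl

/-- `orderingWeight r (e :: t) = orderingWeight r t / r(t.toFinset)`. [cite: Borinsky2020, §6.2 eq. (40)] -/
@[simp] theorem orderingWeight_cons (r : Finset ι → ℝ) (e : ι) (t : List ι) :
    orderingWeight r (e :: t) = orderingWeight r t / r t.toFinset := rfl

/-- With the printed convention `r(∅) = 1` a one-element ordering has weight `1` (empty product in (40)).
[cite: Borinsky2020, §6.2 Definition 28] -/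
theorem orderingWeight_singleton (r : Finset ι → ℝ) (hr0 : r ∅ = 1) (e : ι) : orderingWeight r [e] = 1 := by
  rw [orderingWeight_cons, orderingWeight_nil, List.toFinset_nil, hr0, div_one]

/-- **The identity in the proof of Proposition 29**: "J_r(A) = Σ_{σ : [m] → A} 1/Π_{k=1}^{m−1} r(A^σ_k), where the sum is over all
bijections σ : [m] → A. Fixing such a bijection is equivalent to fixing a pair (e, µ) of an element e ∈ A and a bijection
µ : [m−1] → A∖e." (With `A = [n]` and `r = z_𝒜 − z_ℬ` the right-hand side is `I^tr = Σ_σ I^tr_{C_σ}` of (40), whence Proposition 29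
`I^tr = J_r([n])`.) [cite: Borinsky2020, §6.2 Proposition 29 (proof)] -/
theorem sectorTable_eq_sum_orderingWeight (r : Finset ι → ℝ) (A : Finset ι) :
    sectorTable r A = ∑ l ∈ orderings A, orderingWeight r l := by
  suffices h : ∀ (n : ℕ) (A : Finset ι), A.card = n → sectorTable r A = ∑ l ∈ orderingsAux n A, orderingWeight r l by
    unfold orderings; exact h _ A rfl
  intro n
  induction n with
  | zero =>
    intro A h
    rw [card_eq_zero.mp h]; simp [orderingsAux, sectorTable_empty]
  | succ n ih =>
    intro A h
    have hA : A.Nonempty := card_pos.mp (by omega)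
    rw [sectorTable_eq r hA, orderingsAux]
    have hcard : ∀ e ∈ A, (A.erase e).card = n := fun e he => by rw [card_erase_of_mem he, h, Nat.add_sub_cancel]
    -- the images `e :: _` for different heads `e` are disjoint, and `List.cons e` is injective
    rw [sum_biUnion]
    · refine sum_congr rfl fun e he => ?_
      rw [sum_image (fun t _ t' _ hc => List.tail_eq_of_cons_eq hc), ih _ (hcard e he), sum_div]
      refine sum_congr rfl fun t ht => ?_
      have htA : t.toFinset = A.erase e := by
        have hmem : t ∈ orderings (A.erase e) := by unfold orderings; rw [hcard e he]; exact ht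
        exact (mem_orderings.mp hmem).2
      rw [orderingWeight_cons, htA]
    · intro e _ e' _ hne
      simp only [Function.onFun]
      refine disjoint_left.mpr fun l hl hl' => hne ?_
      obtain ⟨t, -, rfl⟩ := mem_image.mp hl
      obtain ⟨t', -, h'⟩ := mem_image.mp hl'
      exact (List.head_eq_of_cons_eq h').symm

end Orderings

section Algorithm

/-- The probability that Algorithm 4, run from the set `A`, removes the elements in the order given by the list (product of the
one-step probabilities `p_e` along the run; `0` for lists that are not runs from `A`). [cite: Borinsky2020, §6.2 Algorithm 4 and
proof of Proposition 31] -/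
noncomputable def runProb (r : Finset ι → ℝ) : Finset ι → List ι → ℝ
  | A, [] => if A = ∅ then 1 else 0
  | A, e :: t => (if e ∈ A then stepProb r A e else 0) * runProb r (A.erase e) t

/-- **The telescoping in the proof of Proposition 31**: "The terms J_r(A_k∖e_k) telescope, J_r(∅) = r(∅) = 1 and we get
E[f(x)] = (1/J_r(A_n)) Σ_{e_n∈A_n} … Σ_{e_1∈A_1} 1/(r(A_n)⋯r(A_1)) …" — Algorithm 4 outputs the ordering `σ` of `A` with probability
`I^tr_{C_σ}/J_r(A)` (for `r > 0` on proper subsets, so that no `J_r` on the way vanishes). [cite: Borinsky2020, §6.2 proof of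
Proposition 31] -/
theorem runProb_eq (r : Finset ι → ℝ) {A : Finset ι} (hr : ∀ B, B ⊂ A → 0 < r B) {l : List ι} (hl : l ∈ orderings A) :
    runProb r A l = orderingWeight r l / sectorTable r A := by
  induction l generalizing A with
  | nil =>
    obtain ⟨-, hA⟩ := mem_orderings.mp hl
    simp only [List.toFinset_nil] at hA
    subst hA
    simp [runProb, sectorTable_empty]
  | cons e t ih =>
    obtain ⟨hnd, hlA⟩ := mem_orderings.mp hl
    have he : e ∈ A := by rw [← hlA]; simp
    have het : e ∉ t := (List.nodup_cons.mp hnd).1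
    have htA : t.toFinset = A.erase e := by
      rw [← hlA, List.toFinset_cons, erase_insert (fun hm => het (List.mem_toFinset.mp hm))]
    have ht : t ∈ orderings (A.erase e) := mem_orderings.mpr ⟨(List.nodup_cons.mp hnd).2, htA⟩
    have hsub : A.erase e ⊂ A := erase_ssubset he
    have hr' : ∀ B, B ⊂ A.erase e → 0 < r B := fun B hB => hr B (hB.trans hsub)
    have hJ : sectorTable r (A.erase e) ≠ 0 := (sectorTable_pos r hr').ne'
    rw [runProb, if_pos he, ih hr' ht, stepProb, orderingWeight_cons, htA]
    field_simp

/-- Consequently Algorithm 4's output law on orderings is a probability vector: `Σ_σ I^tr_{C_σ}/J_r(A) = 1` (Proposition 29 read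
as the normalisation of the sector-sampling step). [cite: Borinsky2020, §6.2 Propositions 29 and 31] -/
theorem sum_runProb (r : Finset ι → ℝ) {A : Finset ι} (hr : ∀ B, B ⊂ A → 0 < r B) :
    ∑ l ∈ orderings A, runProb r A l = 1 := by
  rw [sum_congr rfl fun l hl => runProb_eq r hr hl, ← sum_div, ← sectorTable_eq_sum_orderingWeight,
    div_self (sectorTable_pos r hr).ne']

/-- `runProb ≥ 0` under the same positivity of `r`. [cite: Borinsky2020, §6.2 Algorithm 4] -/
theorem runProb_nonneg (r : Finset ι → ℝ) {A : Finset ι} (hr : ∀ B, B ⊂ A → 0 < r B) {l : List ι} (hl : l ∈ orderings A) :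
    0 ≤ runProb r A l := by
  rw [runProb_eq r hr hl]
  refine div_nonneg ?_ (sectorTable_pos r hr).le
  obtain ⟨hnd, hlA⟩ := mem_orderings.mp hl
  clear hl
  induction l generalizing A with
  | nil => simp
  | cons e t ih =>
    have het : e ∉ t := (List.nodup_cons.mp hnd).1
    have htA : t.toFinset = A.erase e := by
      rw [← hlA, List.toFinset_cons, erase_insert (fun hm => het (List.mem_toFinset.mp hm))]
    have he : e ∈ A := by rw [← hlA]; simp
    have hsub : A.erase e ⊂ A := erase_ssubset he
    rw [orderingWeight_cons, htA]
    exact div_nonneg (ih (fun B hB => hr B (hB.trans hsub)) (List.nodup_cons.mp hnd).2 htA) (hr _ hsub).le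

end Algorithm

end Literature.MathematicalPhysics.QuantumFieldTheory.Borinsky2020
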